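import Mathlib
import Summits.NavierStokesRegularity.NavierStokesRegularity.Theorems.BarrierStepRungThreeBarrierSoundnessThree
import Summits.NavierStokesRegularity.NavierStokesRegularity.Theses.BarrierStepRungThree
import HarnessLib

/-!
# `BarrierStepRungThree.BarrierSoundnessR` (item stmt-NavierStokesRegularity-24514) — CLOSED by `barrierSoundness₃`

Route `BarrierStepRungThree`, rev 5 (planner ns-idea-4 g3): the ∀-crux `BarrierSoundnessR` is, by
construction, the TYPE of the tree theorem `Theorems.BarrierSoundness.barrierSoundness₃`
(prover ns-bsr3-p1, file `BarrierStepRungThreeBarrierSoundnessThree.lean`): soundness of the repaired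
barrier/clock certificate format K2″ (per-coordinate window caps, one-directional tail bookkeeping) —
every `(η, η)`-pseudo-flow of a Tao-type cascade from the certificate's description steps
(`RobustStep 1 θ c η i₀ α P′ env`), and the description holds at the one-shell datum. This file
closes the item by that theorem.

HONEST FRAMING: the ∀-side (soundness) of a certificate FORMAT for Tao-type MODEL lattice pseudo-flows at
the dyadic scale ratio; the ∃-side (`BarrierCertificateR`, a certificate for SOME comparable table) is the
route's open crux; the rung leaf (`TaoLadderRungThree.Target`, TL-M3) is a MODEL rung, not the summit
Statement. Nothing here is a statement about the Navier–Stokes equations; NS regularity is NOT proved.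
-/

noncomputable section

-- the sub-problem namespace `Summit.NavierStokesRegularity.NavierStokesRegularity` repeats the summit name by design (D-0017)
set_option linter.dupNamespace false

namespace Summit.NavierStokesRegularity.NavierStokesRegularity.Theorems

/-- **Item stmt-NavierStokesRegularity-24514** (`BarrierStepRungThree.BarrierSoundnessR`): the repaired
barrier/clock certificate format is sound — closed by `BarrierSoundness.barrierSoundness₃`, whose
statement the item copies verbatim. [cite: Tao2016AveragedNS, §6.4 Prop. 6.5 with §4 Lemma 4.1
(4.5), (4.8)–(4.11); PrajnaRantzer2007 Thm 3.5 and §3.4] -/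
theorem barrierSoundnessR_proof :
    Summit.NavierStokesRegularity.NavierStokesRegularity.Theses.BarrierStepRungThree.BarrierSoundnessR := by
  unfold Summit.NavierStokesRegularity.NavierStokesRegularity.Theses.BarrierStepRungThree.BarrierSoundnessR
  exact BarrierSoundness.barrierSoundness₃

end Summit.NavierStokesRegularity.NavierStokesRegularity.Theorems

end
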